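import Mathlib
import HarnessLib
import Summits.HubbardSuperconductivity.HubbardSuperconductivity.Theorems.KLProgrammeKLRegimeEngineV8DefsG2
import Summits.HubbardSuperconductivity.HubbardSuperconductivity.Theorems.KLProgrammeKLRegimeSplitPredicatesV3

/-!
# Route `KLProgramme` — crux K3, ENGINE child gen 5 (stmt-HubbardSuperconductivity-19918 `KLRegimeEngineV14`), stub `stub_engine_step_values`,
# conjunct (E2-v9) at `1 ≤ n`: the ANGULAR MASS of slice weights against the crossed-channel gain profile — `klam_sum_mul_profile_le`

Cell gate-hubbard-kl, seat hubbard-kl-k3c1-p1 (g5), technique «composed-map remainder propagation».  Wherever the (E2) remainder carries the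
particle–hole SOURCE `(Klam U)²·phGain n |·|_𝕋` (E2-DRIVE) and is dressed by a resummation with slice weights — inside one Wick step (`T·z·S`
terms), in the tower composition (`kltc_tower_compose{,_fwd}` / `kltc_fourTerm_shaped_le`, input `Σ_b ρ_b·φ(b − c₀) ≤ ε`), or in a cascade through
`klcrf_lipschitz_weighted` — one needs ONE number: the angular mass `ε_n = sup_{c₀} Σ_p ρ_p·phGain n |p − c₀|_𝕋` of a weight profile `ρ` whose
mass near any centre grows at most LINEARLY in the radius, `Σ_{|p − c₀|_𝕋 ≤ η} ρ_p ≤ A·η` for `η ≥ η₀` (the slice annulus has width `≍ Λ_n`: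
k3c2-p2's coarea lane; p1 g8's (ANG) text).  This file is the summation — a WEIGHTED DYADIC LAYER CAKE with a linear distribution bound
against a profile `≤ min(Φ₀, C/r + f)` (§1, generic finite carrier: inner ball `Φ₀·A·r₀`, `I` dyadic shells `2·A·C` each, outer tail `C·Z/(r₀2^I)`,
floor `f·Z`) — and its instance for the package profile `klEngGeo3.phGain n` (§2: `C = r₀ = 2^24·klE0·4^{−n}`, `f = 2^24·√klE0·2^{−n}`,
`I = 2n`): **`ε_n ≤ 2^24·klE0·4^{−n}·A·(1 + 4n) + Z·4^{−n} + 2^24·√klE0·2^{−n}·Z`** — geometric in `n` up to the factor `n`.  E2-DRIVE-FINDING §7's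
estimate, now a theorem.  Arithmetic only; nothing about the model is asserted; 0 kit.
-/

noncomputable section

namespace Summit.HubbardSuperconductivity.HubbardSuperconductivity.Theorems.KLRegimeSplit

set_option linter.dupNamespace false -- summit = problem name (single-conjunct summit), D-0017

open Finset Literature.MathematicalPhysics.QuantumLattice Literature.Probability.LatticeModels
open Summit.HubbardSuperconductivity.HubbardSuperconductivity.Theorems.KLProgrammeLegKernels

/-! ## §1 Weighted dyadic layer cake with a linear distribution bound -/

section Generic

variable {α : Type*} [Fintype α]

/-- **Weighted dyadic layer cake.**  Weights `ρ ≥ 0` with total mass `≤ Z` and LINEAR distribution `Σ_{d(b) ≤ η} ρ_b ≤ A·η` for all `η ≥ η₀`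
around a centre (`d ≥ 0` the distance to it); a profile `φ` with `φ ≤ Φ₀` everywhere and `φ(b) ≤ C/d(b) + f` off the centre.  Then for every
inner radius `r₀ ≥ η₀`, `r₀ > 0`, and every number `I` of dyadic shells,
`Σ_b ρ_b·φ(b) ≤ Φ₀·A·r₀ + f·Z + 2·A·C·I + C·Z/(r₀·2^I)`
(inner ball; floor; shell `i < I`: profile `≤ C/(r₀2^i)`, mass `≤ A·r₀2^{i+1}`; beyond the last shell: profile `≤ C/(r₀2^I)`, mass `≤ Z`). -/
theorem klam_sum_mul_profile_le (ρ φ d : α → ℝ) {η₀ A Z C f Φ₀ r₀ : ℝ} (I : ℕ)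
    (hρ : ∀ b, 0 ≤ ρ b) (hC : 0 ≤ C) (hf : 0 ≤ f) (hΦ₀ : 0 ≤ Φ₀) (hr₀ : 0 < r₀) (hr₀η : η₀ ≤ r₀)
    (hmass : ∀ η : ℝ, η₀ ≤ η → ∑ b ∈ univ.filter (fun b => d b ≤ η), ρ b ≤ A * η) (hZ : ∑ b, ρ b ≤ Z)
    (hφin : ∀ b, φ b ≤ Φ₀) (hφout : ∀ b, 0 < d b → φ b ≤ C / d b + f) :
    ∑ b, ρ b * φ b ≤ Φ₀ * A * r₀ + f * Z + 2 * A * C * I + C * Z / (r₀ * 2 ^ I) := by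
  classical
  -- the piecewise-constant majorant of the profile
  set g : α → ℝ := fun b =>
    Φ₀ * (if d b ≤ r₀ then 1 else 0) + f * (if r₀ < d b then 1 else 0) +
      ∑ i ∈ range I, C / (r₀ * 2 ^ i) * (if r₀ * 2 ^ i < d b ∧ d b ≤ r₀ * 2 ^ (i + 1) then 1 else 0) +
        C / (r₀ * 2 ^ I) * (if r₀ * 2 ^ I < d b then 1 else 0) with hg_def
  have hci : ∀ i : ℕ, 0 ≤ C / (r₀ * 2 ^ i) := fun i => by positivity
  have hshell0 : ∀ b, 0 ≤ ∑ i ∈ range I, C / (r₀ * 2 ^ i) * (if r₀ * 2 ^ i < d b ∧ d b ≤ r₀ * 2 ^ (i + 1) then (1 : ℝ) else 0) :=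
    fun b => sum_nonneg fun i _ => mul_nonneg (hci i) (by split_ifs <;> norm_num)
  have hφg : ∀ b, φ b ≤ g b := by
    intro b
    by_cases hin : d b ≤ r₀
    · -- inner ball
      have h1 : Φ₀ * (if d b ≤ r₀ then (1 : ℝ) else 0) = Φ₀ := by rw [if_pos hin, mul_one]
      have h2 : 0 ≤ f * (if r₀ < d b then (1 : ℝ) else 0) := mul_nonneg hf (by split_ifs <;> norm_num)
      have h4 : 0 ≤ C / (r₀ * 2 ^ I) * (if r₀ * 2 ^ I < d b then (1 : ℝ) else 0) := mul_nonneg (hci I) (by split_ifs <;> norm_num)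
      have := hφin b; have := hshell0 b
      rw [hg_def]; dsimp only; rw [h1]; linarith
    · rw [not_le] at hin
      have hdpos : 0 < d b := hr₀.trans hin
      have hout := hφout b hdpos
      have h1 : 0 ≤ Φ₀ * (if d b ≤ r₀ then (1 : ℝ) else 0) := mul_nonneg hΦ₀ (by split_ifs <;> norm_num)
      have h2 : f * (if r₀ < d b then (1 : ℝ) else 0) = f := by rw [if_pos hin, mul_one]
      by_cases hfar : r₀ * 2 ^ I < d b
      · -- beyond the last shell
        have h4 : C / (r₀ * 2 ^ I) * (if r₀ * 2 ^ I < d b then (1 : ℝ) else 0) = C / (r₀ * 2 ^ I) := by rw [if_pos hfar, mul_one]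
        have h5 : C / d b ≤ C / (r₀ * 2 ^ I) := div_le_div_of_nonneg_left hC (by positivity) hfar.le
        have := hshell0 b
        rw [hg_def]; dsimp only; rw [h2, h4]; linarith
      · -- in a dyadic shell: the least `i` with `d b ≤ r₀ 2^{i+1}`
        rw [not_lt] at hfar
        have hI : 0 < I := by
          rcases Nat.eq_zero_or_pos I with h | h
          · exfalso; rw [h, pow_zero, mul_one] at hfar; linarith
          · exact h
        have hex : ∃ i, d b ≤ r₀ * 2 ^ (i + 1) := ⟨I - 1, by rw [Nat.sub_add_cancel hI]; exact hfar⟩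
        set i₀ := Nat.find hex with hi₀_def
        have hi₀up : d b ≤ r₀ * 2 ^ (i₀ + 1) := Nat.find_spec hex
        have hi₀lt : i₀ < I := by
          have : i₀ ≤ I - 1 := Nat.find_min' hex (by rw [Nat.sub_add_cancel hI]; exact hfar)
          omega
        have hi₀low : r₀ * 2 ^ i₀ < d b := by
          rcases Nat.eq_zero_or_pos i₀ with h | h
          · rw [h, pow_zero, mul_one]; exact hin
          · have hmin := Nat.find_min hex (m := i₀ - 1) (by omega)
            rw [not_le] at hmin
            rw [Nat.sub_add_cancel h] at hmin
            exact hmin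
        have h4 : 0 ≤ C / (r₀ * 2 ^ I) * (if r₀ * 2 ^ I < d b then (1 : ℝ) else 0) := mul_nonneg (hci I) (by split_ifs <;> norm_num)
        have hterm : C / (r₀ * 2 ^ i₀) ≤
            ∑ i ∈ range I, C / (r₀ * 2 ^ i) * (if r₀ * 2 ^ i < d b ∧ d b ≤ r₀ * 2 ^ (i + 1) then (1 : ℝ) else 0) := by
          have hmem : i₀ ∈ range I := mem_range.2 hi₀lt
          have hsingle := single_le_sum (f := fun i => C / (r₀ * 2 ^ i) *
              (if r₀ * 2 ^ i < d b ∧ d b ≤ r₀ * 2 ^ (i + 1) then (1 : ℝ) else 0))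
            (fun i _ => mul_nonneg (hci i) (by split_ifs <;> norm_num)) hmem
          have heq : C / (r₀ * 2 ^ i₀) * (if r₀ * 2 ^ i₀ < d b ∧ d b ≤ r₀ * 2 ^ (i₀ + 1) then (1 : ℝ) else 0) = C / (r₀ * 2 ^ i₀) := by
            rw [if_pos ⟨hi₀low, hi₀up⟩, mul_one]
          rw [heq] at hsingle
          exact hsingle
        have h5 : C / d b ≤ C / (r₀ * 2 ^ i₀) := div_le_div_of_nonneg_left hC (by positivity) hi₀low.le
        rw [hg_def]; dsimp only; rw [h2]; linarith
  -- masses of the regions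
  have hind : ∀ (P : α → Prop) [DecidablePred P], ∑ b, ρ b * (if P b then (1 : ℝ) else 0) = ∑ b ∈ univ.filter P, ρ b := by
    intro P _
    rw [sum_filter]
    exact sum_congr rfl fun b _ => by split_ifs <;> simp
  have hmono : ∀ (P : α → Prop) [DecidablePred P] (η : ℝ), (∀ b, P b → d b ≤ η) → η₀ ≤ η →
      ∑ b, ρ b * (if P b then (1 : ℝ) else 0) ≤ A * η := by
    intro P _ η hP hη
    rw [hind]
    calc ∑ b ∈ univ.filter P, ρ b ≤ ∑ b ∈ univ.filter (fun b => d b ≤ η), ρ b :=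
          sum_le_sum_of_subset_of_nonneg (fun b hb => by
            rw [mem_filter] at hb ⊢; exact ⟨hb.1, hP b hb.2⟩) (fun b _ _ => hρ b)
      _ ≤ A * η := hmass η hη
  have hinner : ∑ b, ρ b * (if d b ≤ r₀ then (1 : ℝ) else 0) ≤ A * r₀ := hmono _ r₀ (fun b hb => hb) hr₀η
  have hall : ∀ (P : α → Prop) [DecidablePred P], ∑ b, ρ b * (if P b then (1 : ℝ) else 0) ≤ Z := by
    intro P _
    calc ∑ b, ρ b * (if P b then (1 : ℝ) else 0) ≤ ∑ b, ρ b :=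
          sum_le_sum fun b _ => by split_ifs <;> nlinarith [hρ b]
      _ ≤ Z := hZ
  have hshell : ∀ i ∈ range I, ∑ b, ρ b * (if r₀ * 2 ^ i < d b ∧ d b ≤ r₀ * 2 ^ (i + 1) then (1 : ℝ) else 0) ≤ A * (r₀ * 2 ^ (i + 1)) := by
    intro i _
    refine hmono _ (r₀ * 2 ^ (i + 1)) (fun b hb => hb.2) (hr₀η.trans ?_)
    have : (1 : ℝ) ≤ 2 ^ (i + 1) := one_le_pow₀ (by norm_num)
    nlinarith
  -- summation
  have hsum_g : ∑ b, ρ b * g b = Φ₀ * ∑ b, ρ b * (if d b ≤ r₀ then (1 : ℝ) else 0) + f * ∑ b, ρ b * (if r₀ < d b then (1 : ℝ) else 0) +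
      ∑ i ∈ range I, C / (r₀ * 2 ^ i) * ∑ b, ρ b * (if r₀ * 2 ^ i < d b ∧ d b ≤ r₀ * 2 ^ (i + 1) then (1 : ℝ) else 0) +
        C / (r₀ * 2 ^ I) * ∑ b, ρ b * (if r₀ * 2 ^ I < d b then (1 : ℝ) else 0) := by
    have hswap : ∑ i ∈ range I, C / (r₀ * 2 ^ i) * ∑ b, ρ b * (if r₀ * 2 ^ i < d b ∧ d b ≤ r₀ * 2 ^ (i + 1) then (1 : ℝ) else 0) =
        ∑ b, ρ b * ∑ i ∈ range I, C / (r₀ * 2 ^ i) * (if r₀ * 2 ^ i < d b ∧ d b ≤ r₀ * 2 ^ (i + 1) then (1 : ℝ) else 0) := by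
      calc ∑ i ∈ range I, C / (r₀ * 2 ^ i) * ∑ b, ρ b * (if r₀ * 2 ^ i < d b ∧ d b ≤ r₀ * 2 ^ (i + 1) then (1 : ℝ) else 0)
          = ∑ i ∈ range I, ∑ b, C / (r₀ * 2 ^ i) * (ρ b * (if r₀ * 2 ^ i < d b ∧ d b ≤ r₀ * 2 ^ (i + 1) then (1 : ℝ) else 0)) :=
            sum_congr rfl fun i _ => by rw [mul_sum]
        _ = ∑ b, ∑ i ∈ range I, C / (r₀ * 2 ^ i) * (ρ b * (if r₀ * 2 ^ i < d b ∧ d b ≤ r₀ * 2 ^ (i + 1) then (1 : ℝ) else 0)) :=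
            sum_comm
        _ = ∑ b, ρ b * ∑ i ∈ range I, C / (r₀ * 2 ^ i) * (if r₀ * 2 ^ i < d b ∧ d b ≤ r₀ * 2 ^ (i + 1) then (1 : ℝ) else 0) :=
            sum_congr rfl fun b _ => by rw [mul_sum]; exact sum_congr rfl fun i _ => by ring
    rw [hswap, mul_sum, mul_sum, mul_sum, ← sum_add_distrib, ← sum_add_distrib, ← sum_add_distrib]
    refine sum_congr rfl fun b _ => ?_
    rw [hg_def]; ring
  calc ∑ b, ρ b * φ b ≤ ∑ b, ρ b * g b := sum_le_sum fun b _ => mul_le_mul_of_nonneg_left (hφg b) (hρ b)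
    _ = _ := hsum_g
    _ ≤ Φ₀ * (A * r₀) + f * Z + ∑ i ∈ range I, C / (r₀ * 2 ^ i) * (A * (r₀ * 2 ^ (i + 1))) + C / (r₀ * 2 ^ I) * Z := by
        refine add_le_add (add_le_add (add_le_add (mul_le_mul_of_nonneg_left hinner hΦ₀) (mul_le_mul_of_nonneg_left (hall _) hf))
          (sum_le_sum fun i hi => mul_le_mul_of_nonneg_left (hshell i hi) (hci i))) (mul_le_mul_of_nonneg_left (hall _) (hci I))
    _ = Φ₀ * A * r₀ + f * Z + 2 * A * C * I + C * Z / (r₀ * 2 ^ I) := by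
        have hterm : ∀ i ∈ range I, C / (r₀ * 2 ^ i) * (A * (r₀ * 2 ^ (i + 1))) = 2 * A * C := by
          intro i _
          have h2i : (2 : ℝ) ^ i ≠ 0 := pow_ne_zero _ two_ne_zero
          field_simp
          ring
        rw [sum_congr rfl hterm, sum_const, card_range, nsmul_eq_mul]
        ring

end Generic

/-! ## §2 The package profile: angular mass against `klEngGeo3.phGain n` -/

section Model

variable (L : ℕ) [NeZero L]

/-- **Angular mass of a linearly distributed weight against the crossed-channel gain profile of `klEngGeo3`.**  If `ρ ≥ 0` on the momentum
torus has total mass `≤ Z` and `Σ_{|p − c₀|_𝕋 ≤ η} ρ_p ≤ A·η` for every `η ≥ 4^{−n}` (p1 g8's (ANG) shape; k3c2-p2's coarea count), then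
`Σ_p ρ_p·klEngGeo3.phGain n |p − c₀|_𝕋 ≤ 2^24·klE0·4^{−n}·A·(1 + 4n) + Z·4^{−n} + 2^24·√klE0·2^{−n}·Z`
(`klam_sum_mul_profile_le` with `Φ₀ = 1`, `C = r₀ = 2^24·klE0·4^{−n}` — the window where `phGain = 1` —, `f = 2^24√klE0·2^{−n}`, `I = 2n`). -/
theorem klam_phGain3_angular_le (ρ : TorusSite 2 L → ℝ) (c₀ : TorusSite 2 L) (n : ℕ) {A Z : ℝ} (hρ : ∀ p, 0 ≤ ρ p)
    (hmass : ∀ η : ℝ, ((4 : ℝ) ^ n)⁻¹ ≤ η → ∑ p ∈ univ.filter (fun p => klTorusNorm L (p - c₀) ≤ η), ρ p ≤ A * η)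
    (hZ : ∑ p, ρ p ≤ Z) :
    ∑ p, ρ p * EngineV8.klEngGeo3.phGain n (klTorusNorm L (p - c₀)) ≤
      (2 : ℝ) ^ 24 * klE0 * ((4 : ℝ) ^ n)⁻¹ * A * (1 + 4 * n) + Z * ((4 : ℝ) ^ n)⁻¹ + 2 ^ 24 * Real.sqrt klE0 * ((2 : ℝ) ^ n)⁻¹ * Z := by
  have he : 0 < klE0 := by norm_num [klE0]
  have he' : (1 : ℝ) ≤ 2 ^ 24 * klE0 := by norm_num [klE0]
  have h4 : (0 : ℝ) < (4 : ℝ) ^ n := by positivity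
  set C : ℝ := 2 ^ 24 * klE0 * ((4 : ℝ) ^ n)⁻¹ with hC_def
  have hC0 : 0 < C := by positivity
  set f : ℝ := 2 ^ 24 * Real.sqrt klE0 * ((2 : ℝ) ^ n)⁻¹ with hf_def
  have hf0 : 0 ≤ f := by positivity
  have hr₀η : ((4 : ℝ) ^ n)⁻¹ ≤ C := by
    rw [hC_def]
    have : ((4 : ℝ) ^ n)⁻¹ = 1 * ((4 : ℝ) ^ n)⁻¹ := (one_mul _).symm
    rw [this, ← mul_assoc]
    exact mul_le_mul_of_nonneg_right (by linarith) (by positivity)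
  have hZ0 : 0 ≤ Z := (sum_nonneg fun p _ => hρ p).trans hZ
  -- the profile facts
  have hφin : ∀ p, EngineV8.klEngGeo3.phGain n (klTorusNorm L (p - c₀)) ≤ 1 := fun p => klgp_phGainOf_le_one _ _ _ _ _ _ _ _ _
  have hφout : ∀ p, 0 < klTorusNorm L (p - c₀) → EngineV8.klEngGeo3.phGain n (klTorusNorm L (p - c₀)) ≤ C / klTorusNorm L (p - c₀) + f := by
    intro p hd
    show phGainOf (2 ^ 24) (2 ^ 24) (2 ^ 24) (2 ^ 24) 0 klE0 n n (max (klTorusNorm L (p - c₀)) 0) ≤ _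
    rw [max_eq_left hd.le]
    have hcond : 0 * ((4 : ℝ) ^ n)⁻¹ < klTorusNorm L (p - c₀) := by rw [zero_mul]; exact hd
    refine (klgp_phGainOf_le_above (2 ^ 24) (2 ^ 24) (2 ^ 24) (2 ^ 24) 0 klE0 n n hcond).trans (le_of_eq ?_)
    rw [zero_mul, sub_zero, hC_def, hf_def]
    ring
  have h := klam_sum_mul_profile_le ρ (fun p => EngineV8.klEngGeo3.phGain n (klTorusNorm L (p - c₀))) (fun p => klTorusNorm L (p - c₀))
    (2 * n) hρ hC0.le hf0 zero_le_one hC0 hr₀η hmass hZ hφin hφout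
  -- arithmetic: `C/(C·2^{2n}) = 4^{-n}`
  have h22 : (2 : ℝ) ^ (2 * n) = 4 ^ n := by rw [pow_mul]; norm_num
  rw [h22] at h
  have hlast : C * Z / (C * (4 : ℝ) ^ n) = Z * ((4 : ℝ) ^ n)⁻¹ := by
    field_simp
  rw [hlast] at h
  refine h.trans (le_of_eq ?_)
  rw [hC_def, hf_def]; push_cast; ring

end Model

end Summit.HubbardSuperconductivity.HubbardSuperconductivity.Theorems.KLRegimeSplit

end
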